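import Summits.HubbardSuperconductivity.HubbardSuperconductivity.Theses.LiebTwin
import Literature.MathematicalPhysics.QuantumLattice.HubbardRingPerronFrobeniusProofs
import Summits.HubbardSuperconductivity.HubbardSuperconductivity.Theorems.LiebTwinTwinOnsiteCondensationStubPairCoherenceMajorant
import Summits.HubbardSuperconductivity.HubbardSuperconductivity.Theorems.LiebTwinTwinOnsiteCondensationStubSpinFlipMajorant

/-!
# Line `majorant` for crux `TwinOnsiteCondensation` — stmt-HubbardSuperconductivity-15258
(route `LiebTwin`, route-HubbardSuperconductivity-LiebTwin, rank 2; sub-problem `HubbardSuperconductivity`)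

Strategist `planner-cstrat-stmt-HubbardSuperconductivity-15258-b1-0`, 2026-08-17 (mode crux-strategist,
alternative to the registered line `birth`). Published as `Cruxes/TwinOnsiteCondensation/Lines/majorant.lean`.

THE CRUX (K2, by name `…Theses.LiebTwin.TwinOnsiteCondensation`): at some box point
`(U, δ) ∈ (0,4] × [1/10,3/10]` there are `c > 0`, `L₀` such that for every even `L ≥ L₀` and EVERY
normalised `(2n, 0)`-sector ground state `φ` of `hubbardTorus 2 L 1 U` (`n = ⌊(1-δ)L²/2⌋`) the TWIN
`φ̃ = liebVec n |liebW n φ|` has `c·L⁴ ≤ F_s(φ̃) = Re⟨φ̃, (pairField sWave L)ᴴ (pairField sWave L) φ̃⟩`.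

THE LINE (the twin's on-site order is a universal MAJORANT of inter-species coherence). Write
`W = liebW n φ = Q|W|` (polar decomposition on `Config n`). An opposite-spin pair annihilator with
one-body kernel `G`, `O_G = Σ_{x,y} G x y • c_{y↓} c_{x↑}`, acts in Lieb coordinates as
`W ↦ ± Σ G_{xy} a_x W a_yᵀ = X (G ⊗ 1) Y` with `X = [a_x Q |W|^{1/2}]_x`, `Y = [|W|^{1/2} a_yᵀ]_y`, and the
matrix Cauchy–Schwarz `‖X(G⊗1)Y‖_F² ≤ ‖G‖² ‖Y†Y‖_F ‖XX†‖_F` reads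
`‖O_G φ‖² ≤ ‖G‖² · (F_s(φ̃)/2)^{1/2} · (F_s(φ̃')/2)^{1/2}`, `φ̃' = liebVec n |Wᴴ|` the co-twin
(`Y†Y = Σ_y a_y|W|a_yᵀ` is the Lieb matrix of `Σ_y c_{y↑}c_{y↓} φ̃`, `XX† = Σ_x a_x|Wᴴ|a_xᵀ` that of the
co-twin). Yang's bound caps the co-twin factor by `n(L²-n+1) ≤ L⁴/2`, whence the MAJORANT
`‖O_G φ‖⁴ ≤ κ L⁴ F_s(φ̃)` for every contraction `G` (stub M1). The same computation for the spin-flip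
family `O'_G = Σ G x y • c†_{x↑} c_{y↓}` (`W ↦ Σ G a_xᵀ… = X'(G⊗1)Y`, `X'X'† = Σ_x a_xᵀ|Wᴴ|a_x`, whose
Frobenius norm is `F_s(φ̃')/2 + (L² - 2n)` by the `η`-pseudospin identity `‖η⁺χ‖² = ‖η⁻χ‖² + (L²-2n)‖χ‖²`)
gives stub M2. Hence K2 follows from ANY macroscopic opposite-spin coherence of the ground states
themselves — pairing in an arbitrary (even `L`- and `φ`-dependent) contraction channel, OR transverse
spin-density-wave coherence in an arbitrary contraction kernel (stub C, the open heart; implied by the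
summit restricted to the box and made uniform, by `s`/extended-`s`/`d_xy`/triplet opposite-spin pairing,
and by SDW order with a transverse component).

* `stub_pairCoherenceMajorant` (M1, provable now, M): `∃ κ > 0`, for every `L`, `n`, every normalised
  `φ` in the `(n,n)` sector and every contraction `G` on `ℓ²(Λ_L)`:
  `(Re⟨φ, O_Gᴴ O_G φ⟩)² ≤ κ · L⁴ · F_s(liebVec n |liebW n φ|)`.
* `stub_spinFlipMajorant` (M2, provable now, M): the same with `O'_G = Σ G x y • c†_{x↑} c_{y↓}`.
* `stub_someInterspeciesCoherence` (C, open — `T = 0` continuous-symmetry breaking for 2D itinerant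
  fermions, channel-blind): at some box point, `c > 0`, `L₀`: every normalised sector ground state `φ`,
  `L ≥ L₀` even, admits a contraction `G` with `c·L⁴ ≤ Re⟨φ, O_Gᴴ O_G φ⟩` or `c·L⁴ ≤ Re⟨φ, O'_Gᴴ O'_G φ⟩`.
* `TwinOnsiteCondensation_of : C → TwinOnsiteCondensation` (sorry-free; M1, M2 used as THEOREMS — landed p170629 / p170612,
  lead c1 wave 2; the same implication is the TREE THEOREM `…Theorems.LiebTwinMajorant.twinOnsiteCondensation_of_someInterspeciesCoherence`,
  p170734): square the coherence floor and divide by the majorant constant: `F_s(φ̃) ≥ (c²/(κ₁+κ₂)) L⁴`.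

Disproof used: none exists for this crux on 2026-08-17 (`ledger crux ls`: Lines/birth.{lean,md}, PICKED.md;
no `Disproof.lean`, no `Theorems/TwinOnsiteCondensation/Negative/*`); `ledger negatives --problem
HubbardSuperconductivity` = {stmt-1180, stmt-1314}, unrelated. Degenerate-witness pass: `G` is constrained
to be a contraction (no cheating by scaling `G`); `n = 0` gives `0 ≤ 0` in M1/M2; the `(n,n)` sector with
`2n > L²` is empty so the normalisation hypothesis is then contradictory (harmless); C cannot be met by
`φ = 0` (normalised) nor by a huge `G`.
-/

noncomputable section

-- `Summit.<Summit>.<Problem>`: for the single-conjunct summit the duplicate component is mandated (D-0017).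
set_option linter.dupNamespace false
set_option linter.unusedVariables false

namespace Summit.HubbardSuperconductivity.HubbardSuperconductivity.Cruxes.TwinOnsiteCondensation.Majorant

open scoped BigOperators Topology Classical Matrix InnerProductSpace ComplexConjugate
open scoped MatrixOrder Matrix.Norms.L2Operator
open Filter Set Function

open Literature.Hubbard Literature.MathematicalPhysics.QuantumLattice

/-! ## Stub statements (documentation names; the registered stubs below restate them verbatim) -/

/-- **Stub M1 — the pair-coherence majorant.** There is `κ > 0` such that for every side `L`, every `n`,
every normalised `φ` in Lieb's `(n, n)` sector and every contraction kernel `G` on `ℓ²(Λ_L)`, the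
opposite-spin pair annihilator `O_G = Σ_{x,y} G x y • c_{y↓} c_{x↑}` satisfies
`(Re⟨φ, O_Gᴴ O_G φ⟩)² ≤ κ · L⁴ · F_s(liebVec n |liebW n φ|)`: every pairing channel of `φ` is dominated by
the on-site order of its twin (matrix Cauchy–Schwarz in Lieb coordinates, Yang's bound on the co-twin).
[cite: LiebPRL1989, proof of Theorem 1] [cite: Yang1962, §4] -/
def PairCoherenceMajorant : Prop :=
  ∃ κ : ℝ, 0 < κ ∧ ∀ (L : ℕ) [NeZero L] (n : ℕ) (φ : Fock (Orb (FermionTorus 2 L))),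
    star φ ⬝ᵥ φ = 1 → IsInSector n n φ →
      ∀ G : Matrix (FermionTorus 2 L) (FermionTorus 2 L) ℂ,
        (∀ v : FermionTorus 2 L → ℂ, (star (G *ᵥ v) ⬝ᵥ (G *ᵥ v)).re ≤ (star v ⬝ᵥ v).re) →
        (expect ((∑ x : FermionTorus 2 L, ∑ y : FermionTorus 2 L,
              G x y • (annihilation (orb y 1) * annihilation (orb x 0)))ᴴ *
            (∑ x : FermionTorus 2 L, ∑ y : FermionTorus 2 L,
              G x y • (annihilation (orb y 1) * annihilation (orb x 0)))) φ).re ^ 2 ≤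
          κ * (L : ℝ) ^ 4 *
            (expect ((pairField sWave L)ᴴ * pairField sWave L)
              (liebVec n (CFC.abs (liebW n φ)))).re

/-- **Stub M2 — the spin-flip (transverse spin-density) majorant.** The same domination for the
spin-flip family `O'_G = Σ_{x,y} G x y • c†_{x↑} c_{y↓}` (in Lieb coordinates `W ↦ Σ G a_xᵀ W a_yᵀ`; the
co-twin factor is `‖η⁺ φ̃'‖² = ‖η⁻ φ̃'‖² + (L² - 2n)`, capped by Yang).
[cite: LiebPRL1989, proof of Theorem 1] [cite: Yang1989, eq. (4)] [cite: Yang1962, §4] -/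
def SpinFlipMajorant : Prop :=
  ∃ κ : ℝ, 0 < κ ∧ ∀ (L : ℕ) [NeZero L] (n : ℕ) (φ : Fock (Orb (FermionTorus 2 L))),
    star φ ⬝ᵥ φ = 1 → IsInSector n n φ →
      ∀ G : Matrix (FermionTorus 2 L) (FermionTorus 2 L) ℂ,
        (∀ v : FermionTorus 2 L → ℂ, (star (G *ᵥ v) ⬝ᵥ (G *ᵥ v)).re ≤ (star v ⬝ᵥ v).re) →
        (expect ((∑ x : FermionTorus 2 L, ∑ y : FermionTorus 2 L,
              G x y • (creation (orb x 0) * annihilation (orb y 1)))ᴴ *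
            (∑ x : FermionTorus 2 L, ∑ y : FermionTorus 2 L,
              G x y • (creation (orb x 0) * annihilation (orb y 1)))) φ).re ^ 2 ≤
          κ * (L : ℝ) ^ 4 *
            (expect ((pairField sWave L)ᴴ * pairField sWave L)
              (liebVec n (CFC.abs (liebW n φ)))).re

/-- **Stub C — some inter-species coherence of the repulsive ground states (the open heart).** At some box
point `(U, δ) ∈ (0,4] × [1/10,3/10]` there are `c > 0`, `L₀` such that for every even `L ≥ L₀` EVERY
normalised `(2n, 0)`-sector ground state `φ` of `hubbardTorus 2 L 1 U` (`n = ⌊(1-δ)L²/2⌋`) carries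
macroscopic opposite-spin coherence in SOME contraction kernel `G` (allowed to depend on `L` and `φ`):
`c·L⁴ ≤ Re⟨φ, O_Gᴴ O_G φ⟩` (pairing in the channel `G`: on-site or extended `s`, `d_{x²-y²}`, `d_{xy}`,
opposite-spin triplet, …) or `c·L⁴ ≤ Re⟨φ, O'_Gᴴ O'_G φ⟩` (transverse spin-density-wave coherence with
profile `G`). Channel-blind; implied by the summit restricted to the box (made uniform) and by SDW order.
[cite: Scalapino1995, §2 eq. (2.4)] [cite: Yang1962, §4] [cite: ArovasBergKivelsonRaghu2022, §5.1.3] -/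
def SomeInterspeciesCoherence : Prop :=
  ∃ U ∈ Set.Ioc (0 : ℝ) 4, ∃ δ ∈ Set.Icc (1 / 10 : ℝ) (3 / 10), ∃ c : ℝ, 0 < c ∧ ∃ L₀ : ℕ,
    ∀ (L : ℕ) [NeZero L], L₀ ≤ L → Even L →
      ∀ φ : Fock (Orb (FermionTorus 2 L)), star φ ⬝ᵥ φ = 1 →
        IsGroundStateInSector (hubbardTorus 2 L 1 U) (2 * ⌊(1 - δ) * (L : ℝ) ^ 2 / 2⌋₊) 0 φ →
        ∃ G : Matrix (FermionTorus 2 L) (FermionTorus 2 L) ℂ,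
          (∀ v : FermionTorus 2 L → ℂ, (star (G *ᵥ v) ⬝ᵥ (G *ᵥ v)).re ≤ (star v ⬝ᵥ v).re) ∧
          (c * (L : ℝ) ^ 4 ≤
              (expect ((∑ x : FermionTorus 2 L, ∑ y : FermionTorus 2 L,
                    G x y • (annihilation (orb y 1) * annihilation (orb x 0)))ᴴ *
                  (∑ x : FermionTorus 2 L, ∑ y : FermionTorus 2 L,
                    G x y • (annihilation (orb y 1) * annihilation (orb x 0)))) φ).re ∨
            c * (L : ℝ) ^ 4 ≤
              (expect ((∑ x : FermionTorus 2 L, ∑ y : FermionTorus 2 L,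
                    G x y • (creation (orb x 0) * annihilation (orb y 1)))ᴴ *
                  (∑ x : FermionTorus 2 L, ∑ y : FermionTorus 2 L,
                    G x y • (creation (orb x 0) * annihilation (orb y 1)))) φ).re)

/-! ## Registered stubs (signatures explicit, tree vocabulary only; M1 and M2 are PROVED from the tree, the ONLY `sorry` left is stub C) -/

/-- stub M1: the pair-coherence majorant — PROVED (worker w2, p170629: `…Theorems.LiebTwinMajorant.stub_pairCoherenceMajorant`,
κ = 1, via CORE-1 `frobenius_block_cauchy_schwarz` + CORE-2 `exists_mul_eq_conjTranspose_mul_eq_cfcAbs` (p169717),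
transfer `expect_pairChannel_eq` (p169886), co-twin cap `sum_norm_sq_configPair_le` (p170547)). Statement =
`PairCoherenceMajorant`, spelled out. [cite: LiebPRL1989, proof of Theorem 1] [cite: Yang1962, §4] -/
theorem stub_pairCoherenceMajorant :
    ∃ κ : ℝ, 0 < κ ∧ ∀ (L : ℕ) [NeZero L] (n : ℕ) (φ : Fock (Orb (FermionTorus 2 L))),
      star φ ⬝ᵥ φ = 1 → IsInSector n n φ →
        ∀ G : Matrix (FermionTorus 2 L) (FermionTorus 2 L) ℂ,
          (∀ v : FermionTorus 2 L → ℂ, (star (G *ᵥ v) ⬝ᵥ (G *ᵥ v)).re ≤ (star v ⬝ᵥ v).re) →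
          (expect ((∑ x : FermionTorus 2 L, ∑ y : FermionTorus 2 L,
                G x y • (annihilation (orb y 1) * annihilation (orb x 0)))ᴴ *
              (∑ x : FermionTorus 2 L, ∑ y : FermionTorus 2 L,
                G x y • (annihilation (orb y 1) * annihilation (orb x 0)))) φ).re ^ 2 ≤
            κ * (L : ℝ) ^ 4 *
              (expect ((pairField sWave L)ᴴ * pairField sWave L)
                (liebVec n (CFC.abs (liebW n φ)))).re :=
  Summit.HubbardSuperconductivity.HubbardSuperconductivity.Theorems.LiebTwinMajorant.stub_pairCoherenceMajorant

/-- stub M2: the spin-flip majorant — PROVED (worker w3, p170612: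
`…Theorems.LiebTwinMajorant.stub_spinFlipMajorant`, κ = 1/2, via the same core, spin-flip transfer
`SpinFlip.re_expect_spinFlip_eq_sum_norm_sq` (p170107) and creation-side cap `SpinFlip.sum_norm_sq_sum_creation_conj_le`
(p170106)). Statement = `SpinFlipMajorant`, spelled out.
[cite: LiebPRL1989, proof of Theorem 1] [cite: Yang1989, eq. (4)] -/
theorem stub_spinFlipMajorant :
    ∃ κ : ℝ, 0 < κ ∧ ∀ (L : ℕ) [NeZero L] (n : ℕ) (φ : Fock (Orb (FermionTorus 2 L))),
      star φ ⬝ᵥ φ = 1 → IsInSector n n φ →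
        ∀ G : Matrix (FermionTorus 2 L) (FermionTorus 2 L) ℂ,
          (∀ v : FermionTorus 2 L → ℂ, (star (G *ᵥ v) ⬝ᵥ (G *ᵥ v)).re ≤ (star v ⬝ᵥ v).re) →
          (expect ((∑ x : FermionTorus 2 L, ∑ y : FermionTorus 2 L,
                G x y • (creation (orb x 0) * annihilation (orb y 1)))ᴴ *
              (∑ x : FermionTorus 2 L, ∑ y : FermionTorus 2 L,
                G x y • (creation (orb x 0) * annihilation (orb y 1)))) φ).re ^ 2 ≤
            κ * (L : ℝ) ^ 4 *
              (expect ((pairField sWave L)ᴴ * pairField sWave L)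
                (liebVec n (CFC.abs (liebW n φ)))).re :=
  Summit.HubbardSuperconductivity.HubbardSuperconductivity.Theorems.LiebTwinMajorant.stub_spinFlipMajorant

/-- stub C: some inter-species coherence of every repulsive sector ground state at a box point (open,
load-bearing). Statement = `SomeInterspeciesCoherence`, spelled out.
[cite: Scalapino1995, §2 eq. (2.4)] [cite: ArovasBergKivelsonRaghu2022, §5.1.3] -/
theorem stub_someInterspeciesCoherence :
    ∃ U ∈ Set.Ioc (0 : ℝ) 4, ∃ δ ∈ Set.Icc (1 / 10 : ℝ) (3 / 10), ∃ c : ℝ, 0 < c ∧ ∃ L₀ : ℕ,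
      ∀ (L : ℕ) [NeZero L], L₀ ≤ L → Even L →
        ∀ φ : Fock (Orb (FermionTorus 2 L)), star φ ⬝ᵥ φ = 1 →
          IsGroundStateInSector (hubbardTorus 2 L 1 U) (2 * ⌊(1 - δ) * (L : ℝ) ^ 2 / 2⌋₊) 0 φ →
          ∃ G : Matrix (FermionTorus 2 L) (FermionTorus 2 L) ℂ,
            (∀ v : FermionTorus 2 L → ℂ, (star (G *ᵥ v) ⬝ᵥ (G *ᵥ v)).re ≤ (star v ⬝ᵥ v).re) ∧
            (c * (L : ℝ) ^ 4 ≤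
                (expect ((∑ x : FermionTorus 2 L, ∑ y : FermionTorus 2 L,
                      G x y • (annihilation (orb y 1) * annihilation (orb x 0)))ᴴ *
                    (∑ x : FermionTorus 2 L, ∑ y : FermionTorus 2 L,
                      G x y • (annihilation (orb y 1) * annihilation (orb x 0)))) φ).re ∨
              c * (L : ℝ) ^ 4 ≤
                (expect ((∑ x : FermionTorus 2 L, ∑ y : FermionTorus 2 L,
                      G x y • (creation (orb x 0) * annihilation (orb y 1)))ᴴ *
                    (∑ x : FermionTorus 2 L, ∑ y : FermionTorus 2 L,
                      G x y • (creation (orb x 0) * annihilation (orb y 1)))) φ).re) := by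
  sorry

/-! ## Name-keyed aliases of the stub statements — the hypotheses of `TwinOnsiteCondensation_of` -/
namespace __Registered

/-- Alias of `PairCoherenceMajorant` keyed by the registered stub name. -/
abbrev stub_pairCoherenceMajorant : Prop := PairCoherenceMajorant
/-- Alias of `SpinFlipMajorant` keyed by the registered stub name. -/
abbrev stub_spinFlipMajorant : Prop := SpinFlipMajorant
/-- Alias of `SomeInterspeciesCoherence` keyed by the registered stub name. -/
abbrev stub_someInterspeciesCoherence : Prop := SomeInterspeciesCoherence

end __Registered

/-! ## Real-number bookkeeping (no `sorry`) -/

/-- Squaring a coherence floor against a majorant: from `c·X ≤ R`, `R² ≤ κ·X·F` (`c, κ, κ', X > 0`)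
conclude `(c²/(κ+κ'))·X ≤ F`. [folklore] -/
theorem floor_of_sq_le {c κ κ' X R F : ℝ} (hc : 0 < c) (hκ : 0 < κ) (hκ' : 0 < κ') (hX : 0 < X)
    (hR : c * X ≤ R) (hmaj : R ^ 2 ≤ κ * X * F) : c ^ 2 / (κ + κ') * X ≤ F := by
  have hcX : 0 ≤ c * X := by positivity
  have h1 : (c * X) ^ 2 ≤ R ^ 2 := pow_le_pow_left₀ hcX hR 2
  have h2 : c ^ 2 * X * X ≤ κ * F * X := by nlinarith [h1, hmaj]
  have h3 : c ^ 2 * X ≤ κ * F := le_of_mul_le_mul_right h2 hX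
  have h4 : c ^ 2 / (κ + κ') ≤ c ^ 2 / κ :=
    div_le_div_of_nonneg_left (sq_nonneg c) hκ (by linarith)
  have h5 : c ^ 2 / (κ + κ') * X ≤ c ^ 2 / κ * X := mul_le_mul_of_nonneg_right h4 hX.le
  have h6 : c ^ 2 / κ * X ≤ F := by
    rw [div_mul_eq_mul_div, div_le_iff₀ hκ]
    linarith [h3]
  exact h5.trans h6

/-! ## Composition: the crux BY NAME from the three stub statements (no `sorry` below) -/

/-- **TwinOnsiteCondensation_of** — majorants × some inter-species coherence ⟹ K2: at the box point of
stub C every normalised sector ground state `φ` (even `L ≥ L₀`) has a contraction kernel `G` with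
`c·L⁴ ≤ Re⟨φ, O_Gᴴ O_G φ⟩` (or the spin-flip analogue); squaring and the majorant M1 (resp. M2) give
`c²L⁸ ≤ κᵢ L⁴ F_s(φ̃)`, i.e. `F_s(φ̃) ≥ (c²/(κ₁+κ₂)) L⁴`. Conclusion = the route decl, by name. [folklore] -/
theorem TwinOnsiteCondensation_of (hC : __Registered.stub_someInterspeciesCoherence) :
    Summit.HubbardSuperconductivity.HubbardSuperconductivity.Theses.LiebTwin.TwinOnsiteCondensation := by
  -- the two majorants are THEOREMS now (tree: …Theorems.LiebTwinMajorant.stub_pairCoherenceMajorant / stub_spinFlipMajorant)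
  obtain ⟨κ₁, hκ₁, h1⟩ := stub_pairCoherenceMajorant
  obtain ⟨κ₂, hκ₂, h2⟩ := stub_spinFlipMajorant
  obtain ⟨U, hU, δ, hδ, c, hc, L₀, hcoh⟩ := hC
  refine ⟨U, hU, δ, hδ, c ^ 2 / (κ₁ + κ₂), by positivity, L₀, ?_⟩
  intro L _ hL hE φ hφ hgs
  -- the sector ground state lies in Lieb's `(n, n)` sector
  have hsec : IsInSector (⌊(1 - δ) * (L : ℝ) ^ 2 / 2⌋₊) (⌊(1 - δ) * (L : ℝ) ^ 2 / 2⌋₊) φ :=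
    (mem_szSector_two_mul_zero_iff _ φ).1 hgs.1
  have hLpos : (0 : ℝ) < (L : ℝ) := Nat.cast_pos.2 (Nat.pos_of_ne_zero (NeZero.ne L))
  have hL4 : (0 : ℝ) < (L : ℝ) ^ 4 := pow_pos hLpos 4
  obtain ⟨G, hG, hpair | hflip⟩ := hcoh L hL hE φ hφ hgs
  · -- pairing coherence in the channel `G`: use the pair majorant M1
    have hmaj := h1 L _ φ hφ hsec G hG
    have key := floor_of_sq_le hc hκ₁ hκ₂ hL4 hpair hmaj
    simpa using key
  · -- spin-flip coherence with profile `G`: use the spin-flip majorant M2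
    have hmaj := h2 L _ φ hφ hsec G hG
    have key := floor_of_sq_le hc hκ₂ hκ₁ hL4 hflip hmaj
    rw [add_comm] at key
    simpa using key

/-- Wiring check (an `example`, so that `TwinOnsiteCondensation_of` stays the only theorem concluding the
crux): the one remaining registered stub feeds the skeleton theorem as stated. -/
example : Summit.HubbardSuperconductivity.HubbardSuperconductivity.Theses.LiebTwin.TwinOnsiteCondensation :=
  TwinOnsiteCondensation_of stub_someInterspeciesCoherence

/-- The plain-arrow form `SomeInterspeciesCoherence → TwinOnsiteCondensation` (same term): after M1 and M2 landed,
K2 is reduced to stub C alone. -/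
example : SomeInterspeciesCoherence →
    Summit.HubbardSuperconductivity.HubbardSuperconductivity.Theses.LiebTwin.TwinOnsiteCondensation :=
  TwinOnsiteCondensation_of

/-- The original three-arrow shape `M1 → M2 → C → TwinOnsiteCondensation` of the line (M1, M2 now discharged). -/
example : PairCoherenceMajorant → SpinFlipMajorant → SomeInterspeciesCoherence →
    Summit.HubbardSuperconductivity.HubbardSuperconductivity.Theses.LiebTwin.TwinOnsiteCondensation :=
  fun _ _ hC => TwinOnsiteCondensation_of hC

end Summit.HubbardSuperconductivity.HubbardSuperconductivity.Cruxes.TwinOnsiteCondensation.Majorant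

end
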